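import Summits.QuantumFields.BalabanUV.Beta.FP.ResidualModeDeterminant

/-!
# `BalabanUV.Beta.FP.ResidualModeLoewner` — road «FP» for binder row D1, row H′2-IR ∕ IR-3, sub-row **IR-3-ID part 3**: the LOEWNER
# TRANSFER `M_B ≥ c₀ ⟺ L_C ≥ c₀·Mid⁻¹ ⟺ K_C ≤ c₀⁻¹·Mid⁻¹ ⟹ J·Mid⁻¹·Jᵀ ⪯ R^g ⪯ c₀⁻¹·J·Mid⁻¹·Jᵀ` and the INVERTIBILITY CORE of the
# residual-mode matrix, square-root-free, at MODEL level (IR3-DESIGN §1 (I5), owner d1-p3-g5; the reader's INFO-2 of journal l.22790)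

HONEST DEPENDENCY (page 1, mandatory): continuum YM on T⁴ ⇐ BetaPertH ∧ nine spine estimates (0/9 proved); BetaPertH ⇐ (D1) ∧ (D4) ∧
CAP+tail; G-an2-4 gates asym, D1 and NE2/3/4.  HONEST FRAMING (cell contract, verbatim): «discharging `BetaPertH` makes Bałaban's UV
stability UNCONDITIONAL — a real constructive-QFT result; it is NOT the continuum limit and NOT the Clay problem.»  THIS MODULE is [folklore]
finite-dimensional linear algebra (`𝕜` a field for the identities; `ℝ` for every positivity statement) on the cell's own bordered-inverse
dictionary (`Beta.Composition.kkt ∕ blockProp`, `Beta.CompositionSingular.flucCov`) and parts 1∕2 `FP/ResidualModeIdentities` (p239055) ∕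
`FP/ResidualModeDeterminant` (p239573) BY NAME; MODEL level; no `def`, no `def … : Prop`, nothing cited, 0 `sorry`; 0 estimates of Bałaban's;
the ellipticity constant `c₀` is a HYPOTHESIS LETTER throughout (IR-3-ELL proper — the n-free symbol inequality `m_B ≥ c₀` — is the
symbol-side row `FP/ResidualModeSymbolBound` of beta-d1-formalise-leaf-02, NOT this file, and the Plancherel passage from the symbol inequality
to the model hypothesis `hEll` below is NOT here either); 0∕4 binders of row D1; NOT IR-3-ELL ∕ LOC ∕ RG, NOT hbook, NOT hasym, NOT D1,
NOT BetaPertH, NOT continuum, NOT Clay.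

ABSOLUTE RULE (cell charter, verbatim): «No internally-minted statement may enter as a cited fact. Every hypothesis is either kernel-proved in this
package or a verbatim quotation of a PUBLISHED theorem with page reference. The manuscript(s) under audit are NOT citable for their own disputed
steps — they are the thing under adjudication; programme-internal (2001/route/tribunal) claims are never citable.»

THE READING (IR3-DESIGN §0–§1; orientation only, nothing of it is asserted here).  Letters of part 1: fine form `H` (`H ≻ 0` over `ℝ`),
`P := H⁻¹`, block averaging `Q`, `Γ₀ := flucCov H Q`, `G_C := (blockProp H Q)⁻¹`, RAW deficit rows `F` (`= Q′Δ⁻¹d*`) with `F P Fᵀ = Mid`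
(`= Q′Δ⁻²Q′ᵀ ≻ 0`), `S₀ := QPFᵀ`, `K_C⁻¹ := Mid − FΓ₀Fᵀ` (`= S₀ᵀG_CS₀ = Mid·L_C·Mid = Mid^{1/2}M_B Mid^{1/2}`), `J := Γ₀Fᵀ`,
`R^g := flucCov (H − FᵀMid⁻¹F) Q − Γ₀` (`= J·K_C·Jᵀ`, part 1 (I5)).  IR3-DESIGN (I5): «ELLIPTICITY `L_C ≥ c₀·Mid⁻¹` (⟺ `M_B ≥ c₀` ⟺
`K_C ≤ c₀⁻¹·Mid⁻¹`) and LOCALITY of `K_C`; `R^g`'s letters come from `J` and `K_C`».  In raw letters `M_B ≥ c₀` reads `(K_C⁻¹ − c₀·Mid) ⪰ 0`.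

CONTENT (Loewner statements are written `(A − B).PosSemidef`, as in part 1; no order instance is used).
* §1 [folklore] LOEWNER TOOLS over `ℝ`: quadratic-form reading; PSD + invertible ⟹ PD (part 1's division-free Cauchy–Schwarz, no spectral
  theorem); **inverse antitonicity** `A ≻ 0, B ≻ 0, 0 < c, (A − c•B) ⪰ 0 ⟹ (c⁻¹•B⁻¹ − A⁻¹) ⪰ 0` (division-free); congruence; scaling;
  the BILINEAR ∕ POINTWISE LETTERS of a dominated PSD kernel `0 ⪯ R ⪯ D ⟹ (u⬝Rv)² ≤ (u⬝Du)(v⬝Dv)`, `(R x y)² ≤ D x x·D y y`.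
* §2 THE INVERTIBILITY CORE (INFO-2 of the XREAD l.22790): `(H − FᵀMid⁻¹F)·(H⁻¹Fᵀ) = 0` (the downdated fine form kills the `|κ|` modes
  `H⁻¹Fᵀ`; for nonempty `κ` it is NEVER invertible alone); `IsUnit (kkt (H − FᵀMid⁻¹F) Q).det ⟺ IsUnit (Mid − FΓ₀Fᵀ).det` (any field);
  over `ℝ`: `G_C ≻ 0` and **`(Mid − FΓ₀Fᵀ) ≻ 0 ⟺ Function.Injective (QH⁻¹Fᵀ).mulVec`** (`S₀` of full column rank).
* §3 THE TRANSFER: from `hK : IsUnit (Mid − FΓ₀Fᵀ).det` ALONE: `K_C ≻ 0`, `(K_C − Mid⁻¹) ⪰ 0`, `R^g ⪰ 0`, **`(R^g − J·Mid⁻¹·Jᵀ) ⪰ 0`**;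
  from ELL `hEll : (Mid − FΓ₀Fᵀ − c₀•Mid).PosSemidef`, `0 < c₀`, `Mid ≻ 0`: `(Mid − FΓ₀Fᵀ) ≻ 0` (the `hK` of parts 1∕2 DISCHARGED),
  **`(c₀⁻¹•Mid⁻¹ − K_C) ⪰ 0`**, **`(c₀⁻¹•(J·Mid⁻¹·Jᵀ) − R^g) ⪰ 0`**, the bilinear and pointwise letters of `R^g` against
  `D := J·Mid⁻¹·Jᵀ = Γ₀FᵀMid⁻¹FΓ₀`; and BOTH CURRENCIES of the owner's GO (journal l.22907) plus the third reading:
  `(K_C⁻¹ − c₀Mid) ⪰ 0 ⟺ (c₀⁻¹Mid⁻¹ − K_C) ⪰ 0 ⟺ (Mid⁻¹K_C⁻¹Mid⁻¹ − c₀Mid⁻¹) ⪰ 0` (`M_B` ∕ `K_C` ∕ `L_C`).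
Provenance: NE9 formalisation swarm (idle-seat cross-lane duty NE9 → road FP), unit b2b-balaban-t4-ne9-formalise-leaf-08 gen 29, 2026-08-20;
continuation of the lineage's IR-3-ID parts 1∕2 (gen 28).  [folklore], 0 def, 0 cite, 0 sorry.
-/

namespace Summit.QuantumFields.BalabanUV.Beta.FP.ResidualModeLoewner

open scoped Matrix
open Matrix
open Literature.MathematicalPhysics.QuantumFieldTheory.Balaban1983to89.Beta.Composition (kkt blockProp det_kkt_ne_zero)
open Literature.MathematicalPhysics.QuantumFieldTheory.Balaban1983to89.Beta.CompositionSingular (flucCov)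
open Summit.QuantumFields.BalabanUV.Beta.FP.ResidualModeIdentities (dotProduct_mulVec_sq_le weight_sub_deficitCov_eq loewner_sandwich
  resCov_eq_sandwich det_kkt_sub_deficit)

variable {𝕜 : Type*} [Field 𝕜]
variable {ι κ ν μ : Type*} [Fintype ι] [Fintype κ] [Fintype ν] [Fintype μ] [DecidableEq ι] [DecidableEq κ] [DecidableEq ν] [DecidableEq μ]

/-! ## §1 Loewner tools over `ℝ` (no order instance; `(A − B).PosSemidef` throughout) -/

omit [DecidableEq ν] in
/-- [folklore] The quadratic-form reading: `(A − B) ⪰ 0 ⟺ (A − B)` symmetric `∧ ∀ x, ⟨x, Bx⟩ ≤ ⟨x, Ax⟩`. -/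
theorem posSemidef_sub_iff (A B : Matrix ν ν ℝ) :
    (A - B).PosSemidef ↔ (A - B).IsHermitian ∧ ∀ x : ν → ℝ, x ⬝ᵥ B *ᵥ x ≤ x ⬝ᵥ A *ᵥ x := by
  rw [posSemidef_iff_dotProduct_mulVec]
  refine and_congr_right fun _ => forall_congr' fun x => ?_
  rw [star_trivial, sub_mulVec, dotProduct_sub, sub_nonneg]

omit [Fintype ν] [DecidableEq ν] in
/-- [folklore] Diagonal domination: `(D − R) ⪰ 0 ⟹ R x x ≤ D x x`. -/
theorem apply_le_apply_of_posSemidef_sub (D R : Matrix ν ν ℝ) (h : (D - R).PosSemidef) (x : ν) : R x x ≤ D x x := by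
  have h0 : 0 ≤ (D - R) x x := h.diag_nonneg; rw [Matrix.sub_apply] at h0; linarith

/-- [folklore] **A POSITIVE SEMIDEFINITE INVERTIBLE REAL MATRIX IS POSITIVE DEFINITE** — by part 1's division-free Cauchy–Schwarz
(`⟨x, Ax⟩ = 0 ⟹ ⟨w, Ax⟩ = 0 ∀ w ⟹ Ax = 0 ⟹ x = 0`); no spectral theorem. -/
theorem posDef_of_posSemidef_of_isUnit_det (A : Matrix ν ν ℝ) (hA : A.PosSemidef) (hAu : IsUnit A.det) : A.PosDef := by
  refine PosDef.of_dotProduct_mulVec_pos hA.1 fun x hx => ?_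
  have h0x : 0 ≤ x ⬝ᵥ A *ᵥ x := by simpa using hA.dotProduct_mulVec_nonneg x
  rw [star_trivial]; refine lt_of_le_of_ne h0x fun h0 => hx ?_
  have h1 : (A *ᵥ x) ⬝ᵥ (A *ᵥ x) = 0 := by
    have h := dotProduct_mulVec_sq_le A hA x (A *ᵥ x)
    rw [← h0, mul_zero] at h
    exact pow_eq_zero_iff two_ne_zero |>.mp (le_antisymm h (sq_nonneg _))
  have h3 := congrArg (A⁻¹ *ᵥ ·) (dotProduct_self_eq_zero.mp h1)
  simpa only [mulVec_mulVec, Matrix.nonsing_inv_mul A hAu, one_mulVec, mulVec_zero] using h3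

omit [DecidableEq ν] in
/-- [folklore] Scaling: `(A − B) ⪰ 0`, `0 ≤ c ⟹ (c•A − c•B) ⪰ 0`. -/
theorem posSemidef_smul_sub (A B : Matrix ν ν ℝ) (h : (A - B).PosSemidef) {c : ℝ} (hc : 0 ≤ c) :
    (c • A - c • B).PosSemidef := by
  rw [← smul_sub]
  refine PosSemidef.of_dotProduct_mulVec_nonneg ?_ fun x => ?_
  · exact (h.1).smul (IsSelfAdjoint.all c)
  · have h0 : 0 ≤ x ⬝ᵥ (A - B) *ᵥ x := by simpa using h.dotProduct_mulVec_nonneg x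
    rw [star_trivial, smul_mulVec, dotProduct_smul, smul_eq_mul]
    exact mul_nonneg hc h0

omit [DecidableEq ν] in
/-- [folklore] A positive multiple of a positive definite real matrix is positive definite. -/
theorem posDef_smul_of_pos (A : Matrix ν ν ℝ) (hA : A.PosDef) {c : ℝ} (hc : 0 < c) : (c • A).PosDef := by
  refine PosDef.of_dotProduct_mulVec_pos ((hA.1).smul (IsSelfAdjoint.all c)) fun x hx => ?_
  have h0 : 0 < x ⬝ᵥ A *ᵥ x := by simpa using hA.dotProduct_mulVec_pos hx
  rw [star_trivial, smul_mulVec, dotProduct_smul, smul_eq_mul]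
  exact mul_pos hc h0

/-- [folklore] **LOEWNER ANTITONICITY OF THE INVERSE, DIVISION-FREE**: for positive definite `A B : Matrix ν ν ℝ` and `0 < c`,
`(A − c•B) ⪰ 0 ⟹ (c⁻¹•B⁻¹ − A⁻¹) ⪰ 0`.  Proof: with `w := A⁻¹v`, `a := ⟨v, A⁻¹v⟩ = ⟨w, Aw⟩ = ⟨w, v⟩`, `b := ⟨v, B⁻¹v⟩`, part 1's
Cauchy–Schwarz for `B` gives `a² ≤ ⟨w, Bw⟩·b ≤ c⁻¹·a·b`, whence `c·a ≤ b`. -/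
theorem posSemidef_inv_sub_inv (A B : Matrix ν ν ℝ) (hA : A.PosDef) (hB : B.PosDef) {c : ℝ} (hc : 0 < c)
    (h : (A - c • B).PosSemidef) : (c⁻¹ • B⁻¹ - A⁻¹).PosSemidef := by
  have hAu : IsUnit A.det := (Matrix.isUnit_iff_isUnit_det A).mp hA.isUnit
  have hBu : IsUnit B.det := (Matrix.isUnit_iff_isUnit_det B).mp hB.isUnit
  have hAis : (A⁻¹)ᵀ = A⁻¹ := by rw [transpose_nonsing_inv, ← conjTranspose_eq_transpose_of_trivial, hA.1.eq]
  have hBis : (B⁻¹)ᵀ = B⁻¹ := by rw [transpose_nonsing_inv, ← conjTranspose_eq_transpose_of_trivial, hB.1.eq]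
  have hle : ∀ u : ν → ℝ, c * (u ⬝ᵥ B *ᵥ u) ≤ u ⬝ᵥ A *ᵥ u := by
    intro u
    have hu := ((posSemidef_sub_iff A (c • B)).mp h).2 u
    rwa [smul_mulVec, dotProduct_smul, smul_eq_mul] at hu
  refine PosSemidef.of_dotProduct_mulVec_nonneg ?_ fun v => ?_
  · show (c⁻¹ • B⁻¹ - A⁻¹)ᴴ = c⁻¹ • B⁻¹ - A⁻¹
    rw [conjTranspose_eq_transpose_of_trivial, transpose_sub, transpose_smul, hAis, hBis]
  · rw [star_trivial, sub_mulVec, dotProduct_sub, sub_nonneg, smul_mulVec, dotProduct_smul, smul_eq_mul]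
    have hAw : A *ᵥ (A⁻¹ *ᵥ v) = v := by rw [mulVec_mulVec, Matrix.mul_nonsing_inv A hAu, one_mulVec]
    have hBw : B *ᵥ (B⁻¹ *ᵥ v) = v := by rw [mulVec_mulVec, Matrix.mul_nonsing_inv B hBu, one_mulVec]
    have ea : (A⁻¹ *ᵥ v) ⬝ᵥ A *ᵥ (A⁻¹ *ᵥ v) = v ⬝ᵥ A⁻¹ *ᵥ v := by rw [hAw, dotProduct_comm]
    have ha0 : 0 ≤ v ⬝ᵥ A⁻¹ *ᵥ v := by simpa using hA.inv.posSemidef.dotProduct_mulVec_nonneg v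
    have hb0 : 0 ≤ v ⬝ᵥ B⁻¹ *ᵥ v := by simpa using hB.inv.posSemidef.dotProduct_mulVec_nonneg v
    have hCS := dotProduct_mulVec_sq_le B hB.posSemidef (B⁻¹ *ᵥ v) (A⁻¹ *ᵥ v)  -- Cauchy–Schwarz for `B`
    rw [hBw, dotProduct_comm (B⁻¹ *ᵥ v) v, dotProduct_comm (A⁻¹ *ᵥ v) v] at hCS
    have hle' := hle (A⁻¹ *ᵥ v); rw [ea] at hle'
    set a := v ⬝ᵥ A⁻¹ *ᵥ v
    set b := v ⬝ᵥ B⁻¹ *ᵥ v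
    set m := (A⁻¹ *ᵥ v) ⬝ᵥ B *ᵥ (A⁻¹ *ᵥ v)
    -- hCS : a ^ 2 ≤ m * b ;  hle' : c * m ≤ a ;  goal : a ≤ c⁻¹ * b
    have h1 : c * a ^ 2 ≤ c * (m * b) := mul_le_mul_of_nonneg_left hCS hc.le
    have h2 : c * m * b ≤ a * b := mul_le_mul_of_nonneg_right hle' hb0
    have key : c * a * a ≤ b * a := by nlinarith [h1, h2]
    have hca : c * a ≤ b := by
      rcases ha0.lt_or_eq with hpos | h0
      · exact le_of_mul_le_mul_right key hpos
      · rw [← h0, mul_zero]; exact hb0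
    calc a = c⁻¹ * (c * a) := by rw [← mul_assoc, inv_mul_cancel₀ hc.ne', one_mul]
      _ ≤ c⁻¹ * b := mul_le_mul_of_nonneg_left hca (inv_nonneg.mpr hc.le)

omit [DecidableEq ι] [DecidableEq ν] in
/-- [folklore] Congruence: `(A − B) ⪰ 0 ⟹ (J·A·Jᵀ − J·B·Jᵀ) ⪰ 0`. -/
theorem posSemidef_congr_sub (A B : Matrix ν ν ℝ) (J : Matrix ι ν ℝ) (h : (A - B).PosSemidef) :
    (J * A * Jᵀ - J * B * Jᵀ).PosSemidef := by
  have e : J * A * Jᵀ - J * B * Jᵀ = J * (A - B) * Jᴴ := by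
    rw [conjTranspose_eq_transpose_of_trivial, Matrix.mul_sub, Matrix.sub_mul]
  rw [e]; exact h.mul_mul_conjTranspose_same J

/-- [folklore] **OFF-DIAGONAL ENTRIES OF A PSD KERNEL**: `R ⪰ 0 ⟹ (R x y)² ≤ R x x · R y y` (Cauchy–Schwarz at coordinate vectors). -/
theorem sq_apply_le_of_posSemidef (R : Matrix ν ν ℝ) (hR : R.PosSemidef) (x y : ν) : (R x y) ^ 2 ≤ R x x * R y y := by
  have h := dotProduct_mulVec_sq_le R hR (Pi.single y 1) (Pi.single x 1)
  simpa only [mulVec_single_one, single_one_dotProduct, col_apply] using h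

omit [DecidableEq ν] in
/-- [folklore] **BILINEAR LETTER OF A DOMINATED KERNEL**: `0 ⪯ R`, `(D − R) ⪰ 0 ⟹ (u ⬝ Rv)² ≤ (u ⬝ Du)·(v ⬝ Dv)` for all `u v` —
at coordinate vectors the sup-norm letter below, at DIFFERENCES `u = e_x − e_{x'}`, `v = e_y − e_{y'}` the finite-difference letters. -/
theorem dotProduct_mulVec_sq_le_of_sub (R D : Matrix ν ν ℝ) (hR : R.PosSemidef) (hD : (D - R).PosSemidef) (u v : ν → ℝ) :
    (u ⬝ᵥ R *ᵥ v) ^ 2 ≤ (u ⬝ᵥ D *ᵥ u) * (v ⬝ᵥ D *ᵥ v) := by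
  have hu := ((posSemidef_sub_iff D R).mp hD).2 u
  have hv := ((posSemidef_sub_iff D R).mp hD).2 v
  have hRu : 0 ≤ u ⬝ᵥ R *ᵥ u := by simpa using hR.dotProduct_mulVec_nonneg u
  have hRv : 0 ≤ v ⬝ᵥ R *ᵥ v := by simpa using hR.dotProduct_mulVec_nonneg v
  exact (dotProduct_mulVec_sq_le R hR v u).trans (mul_le_mul hu hv hRv (hRu.trans hu))

/-- [folklore] **SUP-NORM LETTER OF A DOMINATED KERNEL**: `0 ⪯ R`, `(D − R) ⪰ 0 ⟹ (R x y)² ≤ D x x · D y y` — pointwise bounds of a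
positive semidefinite kernel from the DIAGONAL of a dominating operator. -/
theorem sq_apply_le_of_posSemidef_of_sub (R D : Matrix ν ν ℝ) (hR : R.PosSemidef) (hD : (D - R).PosSemidef) (x y : ν) :
    (R x y) ^ 2 ≤ D x x * D y y := by
  have h := dotProduct_mulVec_sq_le_of_sub R D hR hD (Pi.single x 1) (Pi.single y 1)
  simpa only [mulVec_single_one, single_one_dotProduct, col_apply] using h

/-! ## §2 The invertibility core of the residual-mode matrix (INFO-2 of the XREAD l.22790) -/

/-- [folklore] **THE DOWNDATED FINE FORM KILLS THE `|κ|` MODES `H⁻¹Fᵀ`** (any field): `F H⁻¹ Fᵀ = Mid` with `H`, `Mid` invertible ⟹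
`(H − FᵀMid⁻¹F)·(H⁻¹Fᵀ) = 0` — in the reading, the coarse-visible gauge modes `dΔ⁻²Q′ᵀ` of `H_cov`. -/
theorem downdate_mul_inv_mul_transpose (H : Matrix ν ν 𝕜) (F : Matrix κ ν 𝕜) (Mid : Matrix κ κ 𝕜)
    (hH : IsUnit H.det) (hMid : IsUnit Mid.det) (hF : F * H⁻¹ * Fᵀ = Mid) : (H - Fᵀ * Mid⁻¹ * F) * (H⁻¹ * Fᵀ) = 0 := by
  have e : Fᵀ * Mid⁻¹ * F * (H⁻¹ * Fᵀ) = Fᵀ * (Mid⁻¹ * (F * H⁻¹ * Fᵀ)) := by simp only [Matrix.mul_assoc]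
  rw [Matrix.sub_mul, ← Matrix.mul_assoc H, Matrix.mul_nonsing_inv H hH, Matrix.one_mul, e, hF, Matrix.nonsing_inv_mul Mid hMid,
    Matrix.mul_one, sub_self]

/-- [folklore] Hence, for NONEMPTY `κ`, the downdated fine form `H − FᵀMid⁻¹F` is NEVER invertible on its own (`F ≠ 0` because
`F H⁻¹ Fᵀ = Mid` is invertible) — the reason parts 1∕2 border it by `Q` and never invert it. -/
theorem not_isUnit_det_downdate [Nonempty κ] (H : Matrix ν ν 𝕜) (F : Matrix κ ν 𝕜) (Mid : Matrix κ κ 𝕜) (hH : IsUnit H.det)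
    (hMid : IsUnit Mid.det) (hF : F * H⁻¹ * Fᵀ = Mid) : ¬ IsUnit (H - Fᵀ * Mid⁻¹ * F).det := by
  intro hu
  have h0 := downdate_mul_inv_mul_transpose H F Mid hH hMid hF
  have h1 : H⁻¹ * Fᵀ = 0 := by
    have h := congrArg ((H - Fᵀ * Mid⁻¹ * F)⁻¹ * ·) h0
    simpa only [← Matrix.mul_assoc, Matrix.nonsing_inv_mul _ hu, Matrix.one_mul, Matrix.mul_zero] using h
  have h2 : Fᵀ = 0 := by
    have h := congrArg (H * ·) h1
    rwa [← Matrix.mul_assoc, Matrix.mul_nonsing_inv H hH, Matrix.one_mul, Matrix.mul_zero] at h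
  have h3 : Mid = 0 := by rw [← hF, h2, Matrix.mul_zero]
  exact hMid.ne_zero (by rw [h3, det_zero])

/-- [folklore] **THROUGH THE BORDER** (any field): given `IsUnit (kkt H Q).det` and `IsUnit Mid.det`,
`IsUnit (kkt (H − FᵀMid⁻¹F) Q).det ⟺ IsUnit (Mid − F·flucCov H Q·Fᵀ).det` (part 1's `det_kkt_sub_deficit`) — the downdated BORDERED system is
invertible exactly when the residual-mode matrix `K_C⁻¹` is. -/
theorem isUnit_det_kkt_sub_deficit_iff (H : Matrix ν ν 𝕜) (Q : Matrix μ ν 𝕜) (F : Matrix κ ν 𝕜) (Mid : Matrix κ κ 𝕜)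
    (h : IsUnit (kkt H Q).det) (hMid : IsUnit Mid.det) :
    IsUnit (kkt (H - Fᵀ * Mid⁻¹ * F) Q).det ↔ IsUnit (Mid - F * flucCov H Q * Fᵀ).det := by
  have e := det_kkt_sub_deficit H Q F Mid h hMid
  constructor
  · intro hu
    have h2 : IsUnit ((kkt H Q).det * (Mid - F * flucCov H Q * Fᵀ).det) := by rw [← e]; exact hMid.mul hu
    exact (IsUnit.mul_iff.mp h2).2
  · intro hK
    have h2 : IsUnit (Mid.det * (kkt (H - Fᵀ * Mid⁻¹ * F) Q).det) := by rw [e]; exact h.mul hK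
    exact (IsUnit.mul_iff.mp h2).2

/-- [folklore] **`G_C ≻ 0`**: for `H ≻ 0` over `ℝ` with `blockProp H Q = QH⁻¹Qᵀ` invertible, `blockProp H Q ≻ 0` (hence so is its
inverse `G_C`). -/
theorem posDef_blockProp (H : Matrix ν ν ℝ) (Q : Matrix μ ν ℝ) (hH : H.PosDef) (hP : IsUnit (blockProp H Q).det) :
    (blockProp H Q).PosDef := by
  have hQt : (Qᵀ)ᴴ = Q := by rw [conjTranspose_eq_transpose_of_trivial, transpose_transpose]
  have hbp : (blockProp H Q).PosSemidef := by
    have h := hH.inv.posSemidef.conjTranspose_mul_mul_same Qᵀ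
    rwa [hQt] at h
  exact posDef_of_posSemidef_of_isUnit_det _ hbp hP

omit [DecidableEq κ] in
/-- [folklore] **THE INVERTIBILITY CORE OF IR-3-ELL AT ONE `n`** (INFO-2 of the XREAD l.22790): for `H ≻ 0` over `ℝ` with `blockProp H Q`
invertible and `F H⁻¹ Fᵀ = Mid`,  **`(Mid − F·flucCov H Q·Fᵀ) ≻ 0 ⟺ Function.Injective (QH⁻¹Fᵀ).mulVec`** — the residual-mode matrix
`K_C⁻¹ = S₀ᵀG_CS₀` is positive definite exactly when `S₀ := QH⁻¹Fᵀ` (`= d^c·Mid` in the reading) has full column rank (`G_C ≻ 0`). -/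
theorem posDef_weight_sub_deficitCov_iff (H : Matrix ν ν ℝ) (Q : Matrix μ ν ℝ) (F : Matrix κ ν ℝ) (Mid : Matrix κ κ ℝ)
    (hH : H.PosDef) (hP : IsUnit (blockProp H Q).det) (hF : F * H⁻¹ * Fᵀ = Mid) :
    (Mid - F * flucCov H Q * Fᵀ).PosDef ↔ Function.Injective (Q * H⁻¹ * Fᵀ).mulVec := by
  have hHu : IsUnit H.det := (Matrix.isUnit_iff_isUnit_det H).mp hH.isUnit
  have hHs : Hᵀ = H := by rw [← conjTranspose_eq_transpose_of_trivial]; exact hH.1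
  have hG : ((blockProp H Q)⁻¹).PosDef := (posDef_blockProp H Q hH hP).inv
  rw [weight_sub_deficitCov_eq H Q F Mid hHu hP hHs hF]
  constructor
  · intro hpd v w hvw
    by_contra hne
    have hx : v - w ≠ 0 := sub_ne_zero.mpr hne
    have hpos := hpd.dotProduct_mulVec_pos hx
    have h0 : (Q * H⁻¹ * Fᵀ) *ᵥ (v - w) = 0 := by rw [mulVec_sub, hvw, sub_self]
    rw [← mulVec_mulVec, ← mulVec_mulVec, h0, mulVec_zero, mulVec_zero, dotProduct_zero] at hpos
    exact lt_irrefl _ hpos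
  · intro hinj
    have h := hG.conjTranspose_mul_mul_same hinj
    rwa [conjTranspose_eq_transpose_of_trivial] at h

/-! ## §3 The Loewner transfer: `K_C` and `R^g` against the explicit square-root-free sandwich `J·Mid⁻¹·Jᵀ` -/

/-- [folklore] **`K_C⁻¹ ⪰ 0` and, if invertible, `K_C ≻ 0`**: for `H ≻ 0`, `blockProp H Q` invertible, `F H⁻¹ Fᵀ = Mid` and
`hK : IsUnit (Mid − FΓ₀Fᵀ).det`, the residual-mode matrix `Mid − F·flucCov H Q·Fᵀ` and its inverse `K_C` are positive definite
(part 1's `loewner_sandwich`, lower half, + §1). -/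
theorem posDef_kC (H : Matrix ν ν ℝ) (Q : Matrix μ ν ℝ) (F : Matrix κ ν ℝ) (Mid : Matrix κ κ ℝ) (hH : H.PosDef)
    (hP : IsUnit (blockProp H Q).det) (hF : F * H⁻¹ * Fᵀ = Mid) (hK : IsUnit (Mid - F * flucCov H Q * Fᵀ).det) :
    (Mid - F * flucCov H Q * Fᵀ).PosDef ∧ ((Mid - F * flucCov H Q * Fᵀ)⁻¹).PosDef := by
  have hHu : IsUnit H.det := (Matrix.isUnit_iff_isUnit_det H).mp hH.isUnit
  have hHs : Hᵀ = H := by rw [← conjTranspose_eq_transpose_of_trivial]; exact hH.1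
  have hpsd : (Mid - F * flucCov H Q * Fᵀ).PosSemidef := by
    have h := (loewner_sandwich H Q F Mid hH hP hF).1
    rwa [← weight_sub_deficitCov_eq H Q F Mid hHu hP hHs hF] at h
  have hpd := posDef_of_posSemidef_of_isUnit_det _ hpsd hK
  exact ⟨hpd, hpd.inv⟩

/-- [folklore] **`K_C ⪰ Mid⁻¹` — NO ELLIPTICITY NEEDED**: under the hypotheses of `posDef_kC` and `Mid ≻ 0`, part 1's upper half
`K_C⁻¹ ⪯ Mid` (`F·Γ₀·Fᵀ ⪰ 0`) inverts to `((Mid − FΓ₀Fᵀ)⁻¹ − Mid⁻¹) ⪰ 0`. -/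
theorem posSemidef_kC_sub_inv (H : Matrix ν ν ℝ) (Q : Matrix μ ν ℝ) (F : Matrix κ ν ℝ) (Mid : Matrix κ κ ℝ)
    (hH : H.PosDef) (hP : IsUnit (blockProp H Q).det) (hF : F * H⁻¹ * Fᵀ = Mid) (hMid : Mid.PosDef)
    (hK : IsUnit (Mid - F * flucCov H Q * Fᵀ).det) : ((Mid - F * flucCov H Q * Fᵀ)⁻¹ - Mid⁻¹).PosSemidef := by
  have hHu : IsUnit H.det := (Matrix.isUnit_iff_isUnit_det H).mp hH.isUnit
  have hHs : Hᵀ = H := by rw [← conjTranspose_eq_transpose_of_trivial]; exact hH.1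
  have hup : (Mid - (1 : ℝ) • (Mid - F * flucCov H Q * Fᵀ)).PosSemidef := by
    have h := (loewner_sandwich H Q F Mid hH hP hF).2
    rwa [← weight_sub_deficitCov_eq H Q F Mid hHu hP hHs hF, ← one_smul ℝ (Mid - F * flucCov H Q * Fᵀ)] at h
  have h := posSemidef_inv_sub_inv Mid _ hMid (posDef_kC H Q F Mid hH hP hF hK).1 one_pos hup
  rwa [inv_one, one_smul] at h

/-- [folklore] **ELL IN RAW LETTERS MAKES THE RESIDUAL-MODE MATRIX POSITIVE DEFINITE** (no `H`, no `Q` needed): `Mid ≻ 0`, `0 < c₀`,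
`(K − c₀•Mid) ⪰ 0 ⟹ K ≻ 0`, in particular **`IsUnit K.det`** — at `K := Mid − F·flucCov H Q·Fᵀ` this DISCHARGES the hypothesis `hK` of
part 1's `flucCov_sub_deficit` ∕ `resCov_eq_sandwich` and of part 2's `logZ_sub_deficit` from ellipticity. -/
theorem posDef_of_ell (K Mid : Matrix κ κ ℝ) (hMid : Mid.PosDef) {c₀ : ℝ} (hc : 0 < c₀) (hEll : (K - c₀ • Mid).PosSemidef) :
    K.PosDef ∧ IsUnit K.det := by
  have hpd : K.PosDef := by
    have h := PosDef.posSemidef_add hEll (posDef_smul_of_pos Mid hMid hc)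
    rwa [sub_add_cancel] at h
  exact ⟨hpd, (Matrix.isUnit_iff_isUnit_det K).mp hpd.isUnit⟩

/-- [folklore] **THE TRANSFER `M_B ≥ c₀ ⟹ K_C ≤ c₀⁻¹·Mid⁻¹`** in raw letters: `Mid ≻ 0`, `0 < c₀`, `(K − c₀•Mid) ⪰ 0 ⟹
(c₀⁻¹•Mid⁻¹ − K⁻¹) ⪰ 0` (at `K := Mid − FΓ₀Fᵀ = K_C⁻¹`). -/
theorem posSemidef_inv_sub_kC_of_ell (K Mid : Matrix κ κ ℝ) (hMid : Mid.PosDef) {c₀ : ℝ} (hc : 0 < c₀)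
    (hEll : (K - c₀ • Mid).PosSemidef) : (c₀⁻¹ • Mid⁻¹ - K⁻¹).PosSemidef :=
  posSemidef_inv_sub_inv K Mid (posDef_of_ell K Mid hMid hc hEll).1 hMid hc hEll

/-- [folklore] **THE CONVERSE READING `K_C ≤ c₀⁻¹·Mid⁻¹ ⟹ M_B ≥ c₀`**: `Mid ≻ 0`, `K ≻ 0`, `0 < c₀`, `(c₀⁻¹•Mid⁻¹ − K⁻¹) ⪰ 0 ⟹
(K − c₀•Mid) ⪰ 0` — the readings «`M_B ≥ c₀`» and «`K_C ≤ c₀⁻¹Mid⁻¹`» of IR3-DESIGN (I5) are equivalent at model level. -/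
theorem posSemidef_sub_of_inv_sub_kC (K Mid : Matrix κ κ ℝ) (hMid : Mid.PosDef) (hKpd : K.PosDef) {c₀ : ℝ} (hc : 0 < c₀)
    (h : (c₀⁻¹ • Mid⁻¹ - K⁻¹).PosSemidef) : (K - c₀ • Mid).PosSemidef := by
  have hKu : IsUnit K.det := (Matrix.isUnit_iff_isUnit_det K).mp hKpd.isUnit
  have hMu : IsUnit Mid.det := (Matrix.isUnit_iff_isUnit_det Mid).mp hMid.isUnit
  have h1 : (Mid⁻¹ - c₀ • K⁻¹).PosSemidef := by
    have h' := posSemidef_smul_sub _ _ h hc.le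
    rwa [smul_smul, mul_inv_cancel₀ hc.ne', one_smul] at h'
  have h2 := posSemidef_inv_sub_inv Mid⁻¹ K⁻¹ hMid.inv hKpd.inv hc h1
  rw [Matrix.nonsing_inv_nonsing_inv K hKu, Matrix.nonsing_inv_nonsing_inv Mid hMu] at h2
  have h3 := posSemidef_smul_sub _ _ h2 hc.le
  rwa [smul_smul, mul_inv_cancel₀ hc.ne', one_smul] at h3

/-- [folklore] **THE THIRD READING `L_C ≥ c₀·Mid⁻¹`**: for `Mid ≻ 0`, any `K` and any real `c₀`,
`(K − c₀•Mid) ⪰ 0 ⟹ (Mid⁻¹·K·Mid⁻¹ − c₀•Mid⁻¹) ⪰ 0` (congruence by `Mid⁻¹`; at `K := K_C⁻¹ = Mid·L_C·Mid` the left side is `L_C`). -/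
theorem posSemidef_lC_sub_of_sub (K Mid : Matrix κ κ ℝ) (hMid : Mid.PosDef) (c₀ : ℝ) (h : (K - c₀ • Mid).PosSemidef) :
    (Mid⁻¹ * K * Mid⁻¹ - c₀ • Mid⁻¹).PosSemidef := by
  have hMu : IsUnit Mid.det := (Matrix.isUnit_iff_isUnit_det Mid).mp hMid.isUnit
  have hMs : Midᵀ = Mid := by rw [← conjTranspose_eq_transpose_of_trivial]; exact hMid.1
  have hMis : (Mid⁻¹)ᵀ = Mid⁻¹ := by rw [transpose_nonsing_inv, hMs]
  have h1 := posSemidef_congr_sub K (c₀ • Mid) Mid⁻¹ h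
  rwa [hMis, Matrix.mul_smul, Matrix.smul_mul, Matrix.nonsing_inv_mul Mid hMu, Matrix.one_mul] at h1

/-- [folklore] … and back: `(Mid⁻¹·K·Mid⁻¹ − c₀•Mid⁻¹) ⪰ 0 ⟹ (K − c₀•Mid) ⪰ 0` (congruence by `Mid`) — the readings «`M_B ≥ c₀`» and
«`L_C ≥ c₀·Mid⁻¹`» of IR3-DESIGN (I5) are equivalent at model level. -/
theorem posSemidef_sub_of_lC_sub (K Mid : Matrix κ κ ℝ) (hMid : Mid.PosDef) (c₀ : ℝ) (h : (Mid⁻¹ * K * Mid⁻¹ - c₀ • Mid⁻¹).PosSemidef) :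
    (K - c₀ • Mid).PosSemidef := by
  have hMu : IsUnit Mid.det := (Matrix.isUnit_iff_isUnit_det Mid).mp hMid.isUnit
  have hMs : Midᵀ = Mid := by rw [← conjTranspose_eq_transpose_of_trivial]; exact hMid.1
  have h1 := posSemidef_congr_sub (Mid⁻¹ * K * Mid⁻¹) (c₀ • Mid⁻¹) Mid h
  have e1 : Mid * (Mid⁻¹ * K * Mid⁻¹) * Midᵀ = K := by
    rw [hMs, ← Matrix.mul_assoc, ← Matrix.mul_assoc, Matrix.mul_nonsing_inv Mid hMu, Matrix.one_mul, Matrix.mul_assoc,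
      Matrix.nonsing_inv_mul Mid hMu, Matrix.mul_one]
  have e2 : Mid * (c₀ • Mid⁻¹) * Midᵀ = c₀ • Mid := by
    rw [hMs, Matrix.mul_smul, Matrix.smul_mul, Matrix.mul_nonsing_inv Mid hMu, Matrix.one_mul]
  rwa [e1, e2] at h1

/-- [folklore] **THE RESIDUAL COVARIANCE DOMINATES ITS EXPLICIT SANDWICH — NO ELLIPTICITY NEEDED**: for `H ≻ 0` over `ℝ`, `blockProp H Q`
invertible, `F H⁻¹ Fᵀ = Mid ≻ 0` and `hK : IsUnit (Mid − FΓ₀Fᵀ).det`, with `Γ₀ := flucCov H Q`, `J := Γ₀Fᵀ`,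
`R^g := flucCov (H − FᵀMid⁻¹F) Q − Γ₀`:  **`R^g ⪰ 0`** (the covariant covariance dominates the one shot) and **`(R^g − J·Mid⁻¹·Jᵀ) ⪰ 0`**. -/
theorem resCov_lower (H : Matrix ν ν ℝ) (Q : Matrix μ ν ℝ) (F : Matrix κ ν ℝ) (Mid : Matrix κ κ ℝ) (hH : H.PosDef)
    (hP : IsUnit (blockProp H Q).det) (hF : F * H⁻¹ * Fᵀ = Mid) (hMid : Mid.PosDef) (hK : IsUnit (Mid - F * flucCov H Q * Fᵀ).det) :
    (flucCov (H - Fᵀ * Mid⁻¹ * F) Q - flucCov H Q).PosSemidef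
      ∧ (flucCov (H - Fᵀ * Mid⁻¹ * F) Q - flucCov H Q
          - (flucCov H Q * Fᵀ) * Mid⁻¹ * (flucCov H Q * Fᵀ)ᵀ).PosSemidef := by
  have hHu : IsUnit H.det := (Matrix.isUnit_iff_isUnit_det H).mp hH.isUnit
  have hHs : Hᵀ = H := by rw [← conjTranspose_eq_transpose_of_trivial]; exact hH.1
  have hMu : IsUnit Mid.det := (Matrix.isUnit_iff_isUnit_det Mid).mp hMid.isUnit
  have hkkt : IsUnit (kkt H Q).det := isUnit_iff_ne_zero.mpr (det_kkt_ne_zero H Q hHu hP)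
  have eR := resCov_eq_sandwich H Q F Mid hHs hkkt hMu hK
  refine ⟨?_, ?_⟩
  · rw [eR]
    have h := (posDef_kC H Q F Mid hH hP hF hK).2.posSemidef.mul_mul_conjTranspose_same (flucCov H Q * Fᵀ)
    rwa [conjTranspose_eq_transpose_of_trivial] at h
  · rw [eR]
    exact posSemidef_congr_sub _ _ _ (posSemidef_kC_sub_inv H Q F Mid hH hP hF hMid hK)

/-- [folklore] **THE LOEWNER TRANSFER OF ELLIPTICITY TO THE RESIDUAL COVARIANCE**: for `H ≻ 0` over `ℝ`, `blockProp H Q` invertible,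
`F H⁻¹ Fᵀ = Mid ≻ 0`, and ELL in raw letters `hEll : (Mid − F·Γ₀·Fᵀ − c₀•Mid) ⪰ 0` with `0 < c₀` (`Γ₀ := flucCov H Q`; = `M_B ≥ c₀`):
with `J := Γ₀Fᵀ`, `D := J·Mid⁻¹·Jᵀ`, `R^g := flucCov (H − FᵀMid⁻¹F) Q − Γ₀`,
(i) `IsUnit (Mid − FΓ₀Fᵀ).det`; (ii) `(c₀⁻¹•Mid⁻¹ − K_C) ⪰ 0`; (iii) **`(R^g − D) ⪰ 0 ∧ (c₀⁻¹•D − R^g) ⪰ 0`** — the residual covariance is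
two-sided comparable to the explicit square-root-free sandwich `Γ₀FᵀMid⁻¹FΓ₀`, constants `1` and `c₀⁻¹`. -/
theorem resCov_two_sided_of_ell (H : Matrix ν ν ℝ) (Q : Matrix μ ν ℝ) (F : Matrix κ ν ℝ) (Mid : Matrix κ κ ℝ)
    (hH : H.PosDef) (hP : IsUnit (blockProp H Q).det) (hF : F * H⁻¹ * Fᵀ = Mid) (hMid : Mid.PosDef) {c₀ : ℝ} (hc : 0 < c₀)
    (hEll : (Mid - F * flucCov H Q * Fᵀ - c₀ • Mid).PosSemidef) :
    IsUnit (Mid - F * flucCov H Q * Fᵀ).det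
      ∧ (c₀⁻¹ • Mid⁻¹ - (Mid - F * flucCov H Q * Fᵀ)⁻¹).PosSemidef
      ∧ (flucCov (H - Fᵀ * Mid⁻¹ * F) Q - flucCov H Q - (flucCov H Q * Fᵀ) * Mid⁻¹ * (flucCov H Q * Fᵀ)ᵀ).PosSemidef
      ∧ (c₀⁻¹ • ((flucCov H Q * Fᵀ) * Mid⁻¹ * (flucCov H Q * Fᵀ)ᵀ)
          - (flucCov (H - Fᵀ * Mid⁻¹ * F) Q - flucCov H Q)).PosSemidef := by
  have hHu : IsUnit H.det := (Matrix.isUnit_iff_isUnit_det H).mp hH.isUnit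
  have hHs : Hᵀ = H := by rw [← conjTranspose_eq_transpose_of_trivial]; exact hH.1
  have hMu : IsUnit Mid.det := (Matrix.isUnit_iff_isUnit_det Mid).mp hMid.isUnit
  have hK : IsUnit (Mid - F * flucCov H Q * Fᵀ).det := (posDef_of_ell _ Mid hMid hc hEll).2
  have hKC := posSemidef_inv_sub_kC_of_ell _ Mid hMid hc hEll
  have hkkt : IsUnit (kkt H Q).det := isUnit_iff_ne_zero.mpr (det_kkt_ne_zero H Q hHu hP)
  have eR := resCov_eq_sandwich H Q F Mid hHs hkkt hMu hK
  refine ⟨hK, hKC, (resCov_lower H Q F Mid hH hP hF hMid hK).2, ?_⟩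
  rw [eR]
  have h := posSemidef_congr_sub _ _ (flucCov H Q * Fᵀ) hKC
  rwa [Matrix.mul_smul, Matrix.smul_mul] at h

/-- [folklore] **THE BILINEAR LETTER OF `R^g`**: under the hypotheses of `resCov_two_sided_of_ell`, for all test vectors `u v`
(coordinate vectors: entries; differences of coordinate vectors: the finite differences IR-3-RG sums in windows),
`(u ⬝ R^g v)² ≤ (u ⬝ (c₀⁻¹•D)u)·(v ⬝ (c₀⁻¹•D)v)`, `D := Γ₀FᵀMid⁻¹FΓ₀`. -/
theorem resCov_bilin_sq_le_of_ell (H : Matrix ν ν ℝ) (Q : Matrix μ ν ℝ) (F : Matrix κ ν ℝ) (Mid : Matrix κ κ ℝ)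
    (hH : H.PosDef) (hP : IsUnit (blockProp H Q).det) (hF : F * H⁻¹ * Fᵀ = Mid) (hMid : Mid.PosDef) {c₀ : ℝ} (hc : 0 < c₀)
    (hEll : (Mid - F * flucCov H Q * Fᵀ - c₀ • Mid).PosSemidef) (u v : ν → ℝ) :
    (u ⬝ᵥ (flucCov (H - Fᵀ * Mid⁻¹ * F) Q - flucCov H Q) *ᵥ v) ^ 2
      ≤ (u ⬝ᵥ (c₀⁻¹ • ((flucCov H Q * Fᵀ) * Mid⁻¹ * (flucCov H Q * Fᵀ)ᵀ)) *ᵥ u)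
        * (v ⬝ᵥ (c₀⁻¹ • ((flucCov H Q * Fᵀ) * Mid⁻¹ * (flucCov H Q * Fᵀ)ᵀ)) *ᵥ v) := by
  obtain ⟨hK, -, -, hup⟩ := resCov_two_sided_of_ell H Q F Mid hH hP hF hMid hc hEll
  exact dotProduct_mulVec_sq_le_of_sub _ _ (resCov_lower H Q F Mid hH hP hF hMid hK).1 hup u v

/-- [folklore] **THE POINTWISE LETTER OF `R^g`**: every matrix entry of the residual covariance is controlled by the DIAGONAL of the
explicit sandwich `D := Γ₀FᵀMid⁻¹FΓ₀`:  `(R^g x y)² ≤ (c₀⁻¹·D x x)·(c₀⁻¹·D y y)`. -/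
theorem resCov_apply_sq_le_of_ell (H : Matrix ν ν ℝ) (Q : Matrix μ ν ℝ) (F : Matrix κ ν ℝ) (Mid : Matrix κ κ ℝ)
    (hH : H.PosDef) (hP : IsUnit (blockProp H Q).det) (hF : F * H⁻¹ * Fᵀ = Mid) (hMid : Mid.PosDef) {c₀ : ℝ} (hc : 0 < c₀)
    (hEll : (Mid - F * flucCov H Q * Fᵀ - c₀ • Mid).PosSemidef) (x y : ν) :
    ((flucCov (H - Fᵀ * Mid⁻¹ * F) Q - flucCov H Q) x y) ^ 2
      ≤ (c₀⁻¹ * ((flucCov H Q * Fᵀ) * Mid⁻¹ * (flucCov H Q * Fᵀ)ᵀ) x x)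
        * (c₀⁻¹ * ((flucCov H Q * Fᵀ) * Mid⁻¹ * (flucCov H Q * Fᵀ)ᵀ) y y) := by
  obtain ⟨hK, -, -, hup⟩ := resCov_two_sided_of_ell H Q F Mid hH hP hF hMid hc hEll
  have h := sq_apply_le_of_posSemidef_of_sub _ _ (resCov_lower H Q F Mid hH hP hF hMid hK).1 hup x y
  simpa only [Matrix.smul_apply, smul_eq_mul] using h

end Summit.QuantumFields.BalabanUV.Beta.FP.ResidualModeLoewner
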